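import Summits.Parity.GeneralizedHardyLittlewood.Theorems.LeeYangFibresCellParityLawDefs
import Literature.NumberTheory.Sieve.RoughNumbersBuchstab
import Literature.NumberTheory.Sieve.RoughOmegaCells
import Literature.NumberTheory.Sieve.RoughOmegaCellsWindowTuples
import HarnessLib

/-!
# Route `LeeYangFibres`, crux `CellParityLaw` (stmt-Parity-14109), line `section-annihilator`:
# the registered stub `stub_modelDensityBounds` — anatomy of the rough `Ω`-cells

We prove `ModelDensityBounds` (vocabulary file `LeeYangFibresCellParityLawDefs`): for fixed `u ≥ 2`
and all large `N`, with `a_m = A_m(N)/N`, `A_m(N) = #{n ≤ N : P⁻(n) > N^{1/u}, Ω(n) = m}`,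

* `a_m ≤ C_u / log N` for every `m`: the cells sit inside the rough set `Φ(N, N^{1/u})`, which the
  tree's Buchstab asymptotics (`exists_abs_card_roughIcc_sub_main_le_of_rpow`, `ω ≤ 1`) bound by
  `(1 + C) u N / log N`;
* `a_m ≥ c_u / log N` for `1 ≤ m ≤ u - 1`: the explicit sub-family `n = p₀ p₁ ⋯ p_{k-1} · q`,
  `k = m - 1`, with primes `p_i` in the disjoint windows `(N^{e_i}, N^{e_{i+1}}]`,
  `e_i = 1/u + i/(2u m²)` (so `m e_k < 1`), and a prime `q ∈ (N^{e_k}, N/(p₀⋯p_{k-1})]`; these `n`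
  are distinct by unique factorisation (the tree's `card_sigma_windows_le_card_roughIcc_filter`,
  file `RoughOmegaCellsWindowTuples.lean`), and they are counted from below by Chebyshev's bound
  `π(x) ≥ x/(2 log x)` and Mertens' second theorem in a window (same file);
* `a_m = 0` for `m ≥ u`: a product of `m ≥ u` primes `> N^{1/u}` exceeds `N` (the tree's
  `roughIcc_filter_cardFactors_eq_empty`).

For `m ≥ 1` the model cell is the `Ω = m` cell of the `(⌊N^{1/u}⌋ + 1)`-rough numbers `≤ N` of
`RoughOmegaCells.lean` (`filter_minFac_cardFactors_eq_roughIcc_filter`); no new object is defined.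

Only Chebyshev–Mertens strength is used and no constant is optimised (classically
`A_m(N) ~ I_m(u) N/log N`: K. Alladi, Quart. J. Math. Oxford (2) 33 (1982) 129–148; G. Tenenbaum,
*Introduction to analytic and probabilistic number theory*, III.6). Nothing here is specific to the
crux beyond the shape of `modelDensity`.
-/

noncomputable section

open scoped BigOperators Classical
open Finset Filter Literature.NumberTheory.Sieve

namespace Summit.Parity.GeneralizedHardyLittlewood.Cruxes.CellParityLaw.SectionAnnihilator

/-! ## The model cells are `Ω`-cells of the rough numbers; top cells are empty -/

/-- For `m ≥ 1` the model cell `{1 ≤ n ≤ N : P⁻(n) > N^{1/u}, Ω(n) = m}` (the numerator of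
`modelDensity N u m`) is the `Ω = m` cell of the `(⌊N^{1/u}⌋ + 1)`-rough numbers up to `N`
(`RoughOmegaCells.lean`): for `n ≠ 1`, `N^{1/u} < P⁻(n)` iff every prime factor of `n` is
`≥ ⌊N^{1/u}⌋ + 1`. [folklore] -/
theorem filter_minFac_cardFactors_eq_roughIcc_filter {N u m : ℕ} (hm : 1 ≤ m) :
    (Finset.Icc 1 N).filter (fun n => (N : ℝ) ^ ((1 : ℝ) / u) < (Nat.minFac n : ℝ) ∧
        ArithmeticFunction.cardFactors n = m) =
      (roughIcc (⌊(N : ℝ) ^ ((1 : ℝ) / u)⌋₊ + 1) N).filter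
        (fun b => ArithmeticFunction.cardFactors b = m) := by
  ext n
  simp only [Finset.mem_filter, Finset.mem_Icc, mem_roughIcc]
  constructor
  · rintro ⟨hn, hlt, hΩ⟩
    refine ⟨⟨hn, fun p hp hpn => Nat.succ_le_of_lt ((Nat.floor_lt (by positivity)).2 ?_)⟩, hΩ⟩
    exact hlt.trans_le (by exact_mod_cast Nat.minFac_le_of_dvd hp.two_le hpn)
  · rintro ⟨⟨hn, hall⟩, hΩ⟩
    refine ⟨hn, ?_, hΩ⟩
    have hn1 : n ≠ 1 := by
      rintro rfl
      rw [ArithmeticFunction.cardFactors_one] at hΩ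
      omega
    exact Nat.lt_of_floor_lt (hall _ (Nat.minFac_prime hn1) (Nat.minFac_dvd n))

/-- `modelDensity N u m = #{b ∈ roughIcc (⌊N^{1/u}⌋ + 1) N : Ω b = m} / N` for `m ≥ 1`. -/
theorem modelDensity_eq_card_div {N u m : ℕ} (hm : 1 ≤ m) :
    modelDensity N u m = (((roughIcc (⌊(N : ℝ) ^ ((1 : ℝ) / u)⌋₊ + 1) N).filter
      (fun b => ArithmeticFunction.cardFactors b = m)).card : ℝ) / N := by
  rw [modelDensity, filter_minFac_cardFactors_eq_roughIcc_filter hm]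

/-- Top cells are empty: `a_m = 0` for `m ≥ u ≥ 1`, since no `1 ≤ n ≤ N` has `m` prime factors all
`≥ ⌊N^{1/u}⌋ + 1` (`n ≥ (⌊N^{1/u}⌋ + 1)^m ≥ (⌊N^{1/u}⌋ + 1)^u > N`; the tree's
`roughIcc_filter_cardFactors_eq_empty`). [folklore] -/
theorem modelDensity_eq_zero {N u m : ℕ} (hu : 1 ≤ u) (hm : u ≤ m) : modelDensity N u m = 0 := by
  set M : ℕ := ⌊(N : ℝ) ^ ((1 : ℝ) / u)⌋₊ + 1 with hM
  have hyM : (N : ℝ) ^ ((1 : ℝ) / u) < M := by rw [hM]; push_cast; exact Nat.lt_floor_add_one _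
  have h1 : ((N : ℝ) ^ ((1 : ℝ) / u)) ^ u < (M : ℝ) ^ u :=
    pow_lt_pow_left₀ hyM (by positivity) (by omega)
  rw [one_div, Real.rpow_inv_natCast_pow (Nat.cast_nonneg N) (by omega)] at h1
  have h2 : ((M ^ u : ℕ) : ℝ) ≤ ((M ^ m : ℕ) : ℝ) := by
    exact_mod_cast Nat.pow_le_pow_right (by omega) hm
  push_cast at h2
  have h : N < M ^ m := by exact_mod_cast h1.trans_le h2
  rw [modelDensity_eq_card_div (hu.trans hm), roughIcc_filter_cardFactors_eq_empty h,
    Finset.card_empty, Nat.cast_zero, zero_div]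

/-! ## Upper bound: the cells sit inside the rough set `Φ(N, N^{1/u})` -/

/-- **Upper bound.** For `u ≥ 2` there is `C > 0` with `a_m ≤ C / log N` for all large `N` and all
`m`: `A_m(N) ≤ Φ(N, N^{1/u}) ≤ (N ω(u) - y)/log y + C₀ N/log² y ≤ (1 + C₀) u N/log N` once
`log y = (log N)/u ≥ 1` (Buchstab asymptotics of the tree, `ω ≤ 1`). [folklore] -/
theorem eventually_modelDensity_le {u : ℕ} (hu : 2 ≤ u) :
    ∃ C : ℝ, 0 < C ∧ ∀ᶠ N : ℕ in atTop, ∀ m : ℕ, modelDensity N u m ≤ C / Real.log N := by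
  obtain ⟨C, hC0, hC⟩ := exists_abs_card_roughIcc_sub_main_le_of_rpow (u : ℝ)
  have hu0 : (0 : ℝ) < u := by exact_mod_cast (by omega : 0 < u)
  refine ⟨(1 + C) * u, by positivity, ?_⟩
  have h1 : Tendsto (fun N : ℕ => (N : ℝ) ^ ((1 : ℝ) / u)) atTop atTop :=
    (tendsto_rpow_atTop (by positivity)).comp tendsto_natCast_atTop_atTop
  have h2 : Tendsto (fun N : ℕ => Real.log (N : ℝ)) atTop atTop :=
    Real.tendsto_log_atTop.comp tendsto_natCast_atTop_atTop
  filter_upwards [h1.eventually_ge_atTop 2, h2.eventually_ge_atTop (u : ℝ), eventually_ge_atTop 1]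
    with N hy hlog hN1 m
  unfold modelDensity
  set y : ℝ := (N : ℝ) ^ ((1 : ℝ) / u) with hy_def
  change 2 ≤ y at hy
  change (u : ℝ) ≤ Real.log N at hlog
  have hN : (1 : ℝ) ≤ N := by exact_mod_cast hN1
  have hNpos : (0 : ℝ) < N := by linarith
  have hlogN : 0 < Real.log N := by linarith
  have hyx : y ≤ (N : ℝ) := by
    calc y ≤ (N : ℝ) ^ (1 : ℝ) := Real.rpow_le_rpow_of_exponent_le hN
          ((div_le_one hu0).2 (by exact_mod_cast (by omega : 1 ≤ u)))
      _ = N := Real.rpow_one _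
  have hxy : (N : ℝ) ≤ y ^ (u : ℝ) := by
    rw [hy_def, ← Real.rpow_mul hNpos.le, one_div, inv_mul_cancel₀ hu0.ne', Real.rpow_one]
  have hlogy : Real.log y = Real.log N / u := by
    rw [hy_def, Real.log_rpow hNpos, one_div, inv_mul_eq_div]
  have hlogy1 : 1 ≤ Real.log y := by rw [hlogy, le_div_iff₀ hu0, one_mul]; exact hlog
  have hlogy0 : 0 < Real.log y := by linarith
  have hmain := hC (N : ℝ) y hy hyx hxy
  rw [Nat.floor_natCast] at hmain
  have hω := buchstabOmega_le_one (Real.log N / Real.log y)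
  have hΦ : ((roughIcc ⌈y⌉₊ N).card : ℝ) ≤ (1 + C) * N / Real.log y := by
    have hA : ((N : ℝ) * buchstabOmega (Real.log N / Real.log y) - y) / Real.log y ≤
        N / Real.log y := by
      apply div_le_div_of_nonneg_right _ hlogy0.le
      nlinarith [mul_le_mul_of_nonneg_left hω hNpos.le]
    have hB : C * N / Real.log y ^ 2 ≤ C * N / Real.log y :=
      div_le_div_of_nonneg_left (by positivity) hlogy0 (by nlinarith)
    have := (abs_le.1 hmain).2
    rw [show (1 + C) * N / Real.log y = N / Real.log y + C * N / Real.log y by ring]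
    linarith
  -- the cell sits inside `Φ(N, y)`: every prime factor is at least the least one, `> y`
  have hsub : (Finset.Icc 1 N).filter (fun n => y < (Nat.minFac n : ℝ) ∧
      ArithmeticFunction.cardFactors n = m) ⊆ roughIcc ⌈y⌉₊ N := by
    intro n hn
    rw [Finset.mem_filter, Finset.mem_Icc] at hn
    rw [mem_roughIcc]
    refine ⟨hn.1, fun p hp hpn => Nat.ceil_le.2 (hn.2.1.le.trans ?_)⟩
    exact_mod_cast Nat.minFac_le_of_dvd hp.two_le hpn
  have hcell : (((Finset.Icc 1 N).filter (fun n => y < (Nat.minFac n : ℝ) ∧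
      ArithmeticFunction.cardFactors n = m)).card : ℝ) ≤ ((roughIcc ⌈y⌉₊ N).card : ℝ) := by
    exact_mod_cast Finset.card_le_card hsub
  have hlogNne : Real.log N ≠ 0 := hlogN.ne'
  rw [div_le_div_iff₀ hNpos hlogN]
  refine (mul_le_mul_of_nonneg_right (hcell.trans hΦ) hlogN.le).trans_eq ?_
  rw [hlogy]
  field_simp

/-! ## Lower bound: the window sub-family, counted by Chebyshev and Mertens -/

/-- **Lower bound for one bulk cell.** For `1 ≤ m < u` there is `c > 0` with `a_m ≥ c / log N` for
all large `N`: with `k = m - 1`, `e_i = 1/u + i/(2u m²)` (`m e_k < 1`), every pair `(t, q)` of the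
sub-family gives a member of the cell, and `∑_t #{q} ≥ ∑_t ((N/∏t_i)/(2 log N) - N^{e_k})
≥ (N/(2 log N)) ∏_i (∑_{p ∈ window i} 1/p) - N^{m e_k} ≥ σ N/(4 log N)`. [folklore] -/
theorem eventually_le_modelDensity {u m : ℕ} (hm : 1 ≤ m) (hmu : m < u) :
    ∃ c : ℝ, 0 < c ∧ ∀ᶠ N : ℕ in atTop, c / Real.log N ≤ modelDensity N u m := by
  obtain ⟨k, rfl⟩ : ∃ k, m = k + 1 := ⟨m - 1, by omega⟩
  have hu0 : (0 : ℝ) < u := by exact_mod_cast (by omega : 0 < u)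
  have huk : (k : ℝ) + 2 ≤ u := by exact_mod_cast (by omega : k + 2 ≤ u)
  -- the exponents
  set e : ℕ → ℝ := fun i => 1 / (u : ℝ) + (i : ℝ) / (2 * u * ((k : ℝ) + 1) ^ 2) with he_def
  have he : Monotone e := fun i j hij => by
    simp only [he_def]
    gcongr
  have he0 : e 0 = 1 / u := by simp [he_def]
  have hepos : ∀ i, 0 < e i := fun i => by simp only [he_def]; positivity
  have helt : ∀ i : ℕ, e i < e (i + 1) := fun i => by
    simp only [he_def]
    push_cast
    gcongr
    linarith
  have hγ : ((k : ℝ) + 1) * e k < 1 := by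
    have h2 : ((k : ℝ) + 1) * e k = ((k : ℝ) + 1) / u + k / (2 * u * ((k : ℝ) + 1)) := by
      simp only [he_def]
      field_simp
    have h3 : (k : ℝ) / (2 * u * ((k : ℝ) + 1)) ≤ 1 / (2 * u) := by
      rw [div_le_div_iff₀ (by positivity) (by positivity)]
      nlinarith
    have h4 : ((k : ℝ) + 1) / u + 1 / (2 * u) < 1 := by
      rw [div_add_div _ _ hu0.ne' (by positivity), div_lt_one (by positivity)]
      nlinarith
    linarith
  -- the window constants
  set σ : Fin k → ℝ := fun i => Real.log (e ((i : ℕ) + 1) / e i) / 2 with hσ_def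
  have hσpos : ∀ i, 0 < σ i := fun i =>
    div_pos (Real.log_pos ((one_lt_div (hepos _)).2 (helt _))) two_pos
  set s : ℝ := ∏ i, σ i with hs_def
  have hspos : 0 < s := Finset.prod_pos fun i _ => hσpos i
  set γ : ℝ := ((k : ℝ) + 1) * e k with hγ_def
  set ε : ℝ := (1 - γ) / 2 with hε_def
  have hε : 0 < ε := by simp only [hε_def]; linarith
  have hβ : 0 < 1 - k * e k := by nlinarith [hepos k]
  -- Chebyshev threshold and the eventual conditions in `N`
  obtain ⟨x₀, hx₀⟩ := Filter.eventually_atTop.1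
    (eventually_div_two_log_le_primeCounting.and (eventually_ge_atTop (2 : ℝ)))
  have hT1 : Tendsto (fun N : ℕ => (N : ℝ) ^ (1 - k * e k)) atTop atTop :=
    (tendsto_rpow_atTop hβ).comp tendsto_natCast_atTop_atTop
  have hT2 : Tendsto (fun N : ℕ => (N : ℝ) ^ ε) atTop atTop :=
    (tendsto_rpow_atTop hε).comp tendsto_natCast_atTop_atTop
  have hwin : ∀ᶠ N : ℕ in atTop, ∀ i : Fin k, σ i ≤
      ∑ p ∈ (Finset.Ioc ⌊(N : ℝ) ^ e i⌋₊ ⌊(N : ℝ) ^ e ((i : ℕ) + 1)⌋₊).filter Nat.Prime,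
        (1 : ℝ) / p :=
    Filter.eventually_all.2 fun i => eventually_le_sum_inv_primes_rpow_window (hepos i) (helt i)
  refine ⟨s / 4, by positivity, ?_⟩
  filter_upwards [hwin, hT1.eventually_ge_atTop x₀, hT2.eventually_ge_atTop (4 / (ε * s)),
    eventually_ge_atTop 2] with N hwinN hNx₀ hNε hN2
  change x₀ ≤ (N : ℝ) ^ (1 - k * e k) at hNx₀
  change 4 / (ε * s) ≤ (N : ℝ) ^ ε at hNε
  have hN1 : 1 ≤ N := by omega
  have hN1' : (1 : ℝ) ≤ N := by exact_mod_cast hN1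
  have hNpos : (0 : ℝ) < N := by linarith
  have hlogN : 0 < Real.log N := Real.log_pos (by exact_mod_cast (by omega : 1 < N))
  -- the windows and the sub-family
  set W : Fin k → Finset ℕ := fun i =>
    (Finset.Ioc ⌊(N : ℝ) ^ e i⌋₊ ⌊(N : ℝ) ^ e ((i : ℕ) + 1)⌋₊).filter Nat.Prime with hW_def
  set Q : (Fin k → ℕ) → Finset ℕ := fun t =>
    (Finset.Ioc ⌊(N : ℝ) ^ e k⌋₊ (N / ∏ i, t i)).filter Nat.Prime with hQ_def
  have hcomb := card_sigma_windows_le_card_roughIcc_filter he hN1 W Q (fun i => rfl) (fun t => rfl)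
  rw [Finset.card_sigma, he0] at hcomb
  have hNek : ∀ i : Fin k, ((W i).card : ℝ) ≤ (N : ℝ) ^ e k := fun i => by
    calc ((W i).card : ℝ)
          ≤ ((Finset.Ioc ⌊(N : ℝ) ^ e i⌋₊ ⌊(N : ℝ) ^ e ((i : ℕ) + 1)⌋₊).card : ℝ) := by
          exact_mod_cast Finset.card_filter_le _ _
      _ ≤ ⌊(N : ℝ) ^ e ((i : ℕ) + 1)⌋₊ := by rw [Nat.card_Ioc]; exact_mod_cast Nat.sub_le _ _
      _ ≤ (N : ℝ) ^ e ((i : ℕ) + 1) := Nat.floor_le (by positivity)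
      _ ≤ (N : ℝ) ^ e k := Real.rpow_le_rpow_of_exponent_le hN1' (he i.isLt)
  have htW : ∀ t ∈ Fintype.piFinset W, ∀ i,
      (t i).Prime ∧ ⌊(N : ℝ) ^ e i⌋₊ < t i ∧ (t i : ℝ) ≤ (N : ℝ) ^ e k := by
    intro t ht i
    have h := Fintype.mem_piFinset.1 ht i
    simp only [hW_def, Finset.mem_filter, Finset.mem_Ioc] at h
    refine ⟨h.2, h.1.1, ?_⟩
    calc (t i : ℝ) ≤ ⌊(N : ℝ) ^ e ((i : ℕ) + 1)⌋₊ := by exact_mod_cast h.1.2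
      _ ≤ (N : ℝ) ^ e ((i : ℕ) + 1) := Nat.floor_le (by positivity)
      _ ≤ (N : ℝ) ^ e k := Real.rpow_le_rpow_of_exponent_le hN1' (he i.isLt)
  -- Chebyshev in each fibre
  have hQt : ∀ t ∈ Fintype.piFinset W,
      (N : ℝ) / (∏ i, t i : ℕ) / (2 * Real.log N) - (N : ℝ) ^ e k ≤ ((Q t).card : ℝ) := by
    intro t ht
    set P : ℕ := ∏ i, t i with hP_def
    have hP0 : 0 < P := Finset.prod_pos fun i _ => (htW t ht i).1.pos
    have hP1 : (1 : ℝ) ≤ P := by exact_mod_cast hP0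
    have hPle : (P : ℝ) ≤ (N : ℝ) ^ ((k : ℝ) * e k) := by
      rw [hP_def, Nat.cast_prod]
      calc ∏ i, (t i : ℝ) ≤ ∏ _i : Fin k, (N : ℝ) ^ e k :=
            Finset.prod_le_prod (fun i _ => by positivity) fun i _ => (htW t ht i).2.2
        _ = (N : ℝ) ^ ((k : ℝ) * e k) := by
            rw [Finset.prod_const, Finset.card_univ, Fintype.card_fin, ← Real.rpow_natCast,
              ← Real.rpow_mul hNpos.le]
            congr 1
            ring
    have hx : x₀ ≤ (N : ℝ) / P := by
      refine hNx₀.trans ?_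
      rw [Real.rpow_sub hNpos, Real.rpow_one]
      exact div_le_div_of_nonneg_left hNpos.le (by positivity) hPle
    obtain ⟨hπ, hx2⟩ := hx₀ _ hx
    rw [Nat.floor_div_eq_div] at hπ
    have hcard : (Nat.primeCounting (N / P) : ℝ) - Nat.primeCounting ⌊(N : ℝ) ^ e k⌋₊ ≤
        (Q t).card := by
      have hsub : Nat.primesLE (N / P) ⊆ Nat.primesLE ⌊(N : ℝ) ^ e k⌋₊ ∪ Q t := by
        intro p hp
        rw [Nat.mem_primesLE] at hp
        rw [Finset.mem_union, Nat.mem_primesLE, hQ_def, Finset.mem_filter, Finset.mem_Ioc]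
        by_cases h : p ≤ ⌊(N : ℝ) ^ e k⌋₊
        · exact Or.inl ⟨h, hp.2⟩
        · exact Or.inr ⟨⟨by omega, hp.1⟩, hp.2⟩
      have h := (Finset.card_le_card hsub).trans (Finset.card_union_le _ _)
      rw [Nat.primesLE_card_eq_primeCounting, Nat.primesLE_card_eq_primeCounting] at h
      have h' : ((N / P).primeCounting : ℝ) ≤
          (Nat.primeCounting ⌊(N : ℝ) ^ e k⌋₊ : ℝ) + ((Q t).card : ℝ) := by exact_mod_cast h
      linarith
    have hπA : (Nat.primeCounting ⌊(N : ℝ) ^ e k⌋₊ : ℝ) ≤ (N : ℝ) ^ e k := by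
      calc (Nat.primeCounting ⌊(N : ℝ) ^ e k⌋₊ : ℝ) ≤ ⌊(N : ℝ) ^ e k⌋₊ := by
            rw [← Nat.primesLE_card_eq_primeCounting, Nat.primesLE_eq_filter_Ioc_zero]
            exact_mod_cast (Finset.card_filter_le _ _).trans (by simp)
        _ ≤ (N : ℝ) ^ e k := Nat.floor_le (by positivity)
    have hlogle : Real.log ((N : ℝ) / P) ≤ Real.log N :=
      Real.log_le_log (by positivity) (div_le_self hNpos.le hP1)
    have hlogpos : 0 < Real.log ((N : ℝ) / P) := Real.log_pos (by linarith)
    have hmono : (N : ℝ) / P / (2 * Real.log N) ≤ (N : ℝ) / P / (2 * Real.log ((N : ℝ) / P)) :=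
      div_le_div_of_nonneg_left (by positivity) (by positivity) (by linarith)
    linarith
  -- summing over the window box
  have hsum : s * N / (2 * Real.log N) - (N : ℝ) ^ γ ≤
      ∑ t ∈ Fintype.piFinset W, ((Q t).card : ℝ) := by
    refine le_trans ?_ (Finset.sum_le_sum hQt)
    rw [Finset.sum_sub_distrib, Finset.sum_const, nsmul_eq_mul]
    have h2 : ∑ t ∈ Fintype.piFinset W, (N : ℝ) / (∏ i, t i : ℕ) / (2 * Real.log N) =
        (N : ℝ) / (2 * Real.log N) * ∏ i, ∑ p ∈ W i, (1 : ℝ) / p := by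
      rw [Finset.prod_univ_sum, Finset.mul_sum]
      refine Finset.sum_congr rfl fun t _ => ?_
      rw [Nat.cast_prod]
      simp only [one_div]
      rw [Finset.prod_inv_distrib]
      ring
    have h3 : s * N / (2 * Real.log N) ≤
        (N : ℝ) / (2 * Real.log N) * ∏ i, ∑ p ∈ W i, (1 : ℝ) / p := by
      rw [show s * N / (2 * Real.log N) = (N : ℝ) / (2 * Real.log N) * s by ring]
      refine mul_le_mul_of_nonneg_left ?_ (by positivity)
      exact Finset.prod_le_prod (fun i _ => (hσpos i).le) fun i _ => hwinN i
    have h4 : ((Fintype.piFinset W).card : ℝ) * (N : ℝ) ^ e k ≤ (N : ℝ) ^ γ := by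
      rw [Fintype.card_piFinset, Nat.cast_prod]
      calc (∏ i, ((W i).card : ℝ)) * (N : ℝ) ^ e k
            ≤ (∏ _i : Fin k, (N : ℝ) ^ e k) * (N : ℝ) ^ e k :=
            mul_le_mul_of_nonneg_right
              (Finset.prod_le_prod (fun i _ => by positivity) fun i _ => hNek i) (by positivity)
        _ = (N : ℝ) ^ γ := by
            rw [Finset.prod_const, Finset.card_univ, Fintype.card_fin, ← Real.rpow_natCast,
              ← Real.rpow_mul hNpos.le, ← Real.rpow_add hNpos, hγ_def]
            congr 1
            ring
    rw [h2]
    linarith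
  -- the secondary term is negligible: `N^γ ≤ s N/(4 log N)`
  have hmainγ : (N : ℝ) ^ γ ≤ s * N / (4 * Real.log N) := by
    have hl : Real.log N ≤ (N : ℝ) ^ ε / ε := Real.log_le_rpow_div hNpos.le hε
    have hNsplit : (N : ℝ) = (N : ℝ) ^ γ * (N : ℝ) ^ ε * (N : ℝ) ^ ε := by
      rw [← Real.rpow_add hNpos, ← Real.rpow_add hNpos]
      have : γ + ε + ε = 1 := by rw [hε_def]; ring
      rw [this, Real.rpow_one]
    have h4 : 4 ≤ (N : ℝ) ^ ε * (ε * s) := (div_le_iff₀ (by positivity)).1 hNε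
    rw [le_div_iff₀ (by positivity)]
    calc (N : ℝ) ^ γ * (4 * Real.log N) ≤ (N : ℝ) ^ γ * (4 * ((N : ℝ) ^ ε / ε)) := by gcongr
      _ = (N : ℝ) ^ γ * (N : ℝ) ^ ε * (4 / ε) := by ring
      _ ≤ (N : ℝ) ^ γ * (N : ℝ) ^ ε * (s * (N : ℝ) ^ ε) := by
          gcongr
          rw [div_le_iff₀ hε]
          nlinarith
      _ = s * ((N : ℝ) ^ γ * (N : ℝ) ^ ε * (N : ℝ) ^ ε) := by ring
      _ = s * N := by rw [← hNsplit]
  -- conclusion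
  rw [modelDensity_eq_card_div (Nat.succ_pos k), div_le_div_iff₀ hlogN hNpos]
  have hA : s * N / (2 * Real.log N) - (N : ℝ) ^ γ ≤
      (((roughIcc (⌊(N : ℝ) ^ ((1 : ℝ) / u)⌋₊ + 1) N).filter
        (fun b => ArithmeticFunction.cardFactors b = k + 1)).card : ℝ) :=
    hsum.trans (by exact_mod_cast hcomb)
  have h' : s * N / (2 * Real.log N) - s * N / (4 * Real.log N) = s * N / (4 * Real.log N) := by
    ring
  have hfin : s * N / (4 * Real.log N) ≤
      (((roughIcc (⌊(N : ℝ) ^ ((1 : ℝ) / u)⌋₊ + 1) N).filter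
        (fun b => ArithmeticFunction.cardFactors b = k + 1)).card : ℝ) := by
    linarith
  rw [div_le_iff₀ (by positivity)] at hfin
  linarith

/-! ## The registered stub -/

/-- **`stub_modelDensityBounds`** (registered stub of the line `section-annihilator`): anatomy of
the rough `Ω`-cells — for `u ≥ 2` and all large `N`, `a_m ≤ C_u/log N` for all `m`,
`a_m ≥ c_u/log N` for `1 ≤ m ≤ u - 1`, and `a_m = 0` for `m ≥ u`. -/
theorem stub_modelDensityBounds : ModelDensityBounds := by
  intro u hu
  obtain ⟨C, hC, hCev⟩ := eventually_modelDensity_le hu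
  have hlow : ∀ m ∈ Finset.Ico 1 u, ∃ c : ℝ, 0 < c ∧
      ∀ᶠ N : ℕ in atTop, c / Real.log N ≤ modelDensity N u m := by
    intro m hm
    rw [Finset.mem_Ico] at hm
    exact eventually_le_modelDensity hm.1 hm.2
  choose! c hc hcev using hlow
  have hne : (Finset.Ico 1 u).Nonempty := ⟨1, Finset.mem_Ico.2 ⟨le_rfl, by omega⟩⟩
  obtain ⟨m₀, hm₀, hmin⟩ := Finset.exists_min_image (Finset.Ico 1 u) c hne
  refine ⟨c m₀, C, hc m₀ hm₀, hC, ?_⟩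
  have hev : ∀ᶠ N : ℕ in atTop, ∀ m ∈ Finset.Ico 1 u, c m / Real.log N ≤ modelDensity N u m :=
    (Filter.eventually_all_finset _).2 fun m hm => hcev m hm
  obtain ⟨N₀, hN₀⟩ := Filter.eventually_atTop.1 (hCev.and (hev.and (eventually_ge_atTop 2)))
  refine ⟨N₀, fun N hN => ?_⟩
  obtain ⟨h1, h2, hN2⟩ := hN₀ N hN
  have hlogN : 0 < Real.log N := Real.log_pos (by exact_mod_cast (by omega : 1 < N))
  refine ⟨h1, fun m hm hmu => ?_, fun m hm => ?_⟩
  · have hm' : m ∈ Finset.Ico 1 u := Finset.mem_Ico.2 ⟨hm, hmu⟩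
    calc c m₀ / Real.log N ≤ c m / Real.log N :=
          div_le_div_of_nonneg_right (hmin m hm') hlogN.le
      _ ≤ modelDensity N u m := h2 m hm'
  · exact modelDensity_eq_zero (by omega) hm

end Summit.Parity.GeneralizedHardyLittlewood.Cruxes.CellParityLaw.SectionAnnihilator

end
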